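import Summits.RiemannHypothesis.RiemannHypothesis.Theorems.EtaLeadingQuarterSecondMomentZerosCloser
import Summits.RiemannHypothesis.RiemannHypothesis.Theorems.EtaLeadingQuarterEtaLeadingSecondMomentEvenReduction
import Summits.RiemannHypothesis.RiemannHypothesis.Theses.EtaLeadingQuarter
import HarnessLib

/-!
# The second moment of the sharp eta vector at the zeros, zero side XI: the closer modulo the engine
(route EtaLeadingQuarter, item `EtaLeadingSecondMoment`, stmt-RiemannHypothesis-21791)

`etaLeadingSecondMoment_of_engine` — **`EtaLeadingSecondMoment` (the route decl VERBATIM) follows from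
the per-zero AFE engine** in the agreed shape (HOME/hEng.lean.txt; sibling file
`EtaLeadingQuarterSecondMomentEngine`, to be imported by the final closer):

  `RH → ∃ q ≥ 0, ∀ η ∈ (0, 1/2], ∃ c ≥ 0, ∀ᶠ M, M even → ∀ n ∈ [N(4⌊M/2⌋), N(M²)),`
  `  ‖T_M(1/2+iγ_n)‖ ≤ √2 ‖S(⌊γ_n/(πM)⌋, γ_n)‖ + (c (1+log M)/√M + 1_{d_n ≤ η} q √(M/γ_n))`.

Proof: the even-`M` bound `Zeros.even_bound_of_engine` (zero side I–X), reindexed `M = 2K`, fed to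
the parity reduction `EtaTrial.etaLeadingSecondMoment_of_even` (sibling l18 g2, p584020).
RH enters through the engine and Landau's formula. Nothing here bears on the truth of RH: the
conclusion feeds a rung route onto the RH-free leaf `ScrewFloorLimsupQuarter`.
-/

noncomputable section

open Real Finset Filter Topology Complex

set_option linter.dupNamespace false  -- the mandated namespace repeats `RiemannHypothesis`

namespace Summit.RiemannHypothesis.RiemannHypothesis.Theorems.EtaLeadingQuarter.Zeros

open Literature.NumberTheory.LFunctions NicolasJExplicit

/-- **`EtaLeadingSecondMoment` (stmt-RiemannHypothesis-21791) from the per-zero AFE engine** in the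
agreed shape (even `M`; HOME/hEng.lean.txt): the engine gives the even-`M` bound
(`Zeros.even_bound_of_engine`), the parity reduction `EtaTrial.etaLeadingSecondMoment_of_even` the
odd `M`. [folklore] -/
theorem etaLeadingSecondMoment_of_engine
    (hEng : _root_.RiemannHypothesis → ∃ q : ℝ, 0 ≤ q ∧ ∀ η : ℝ, 0 < η → η ≤ 1 / 2 → ∃ c : ℝ, 0 ≤ c ∧
      ∀ᶠ M : ℕ in atTop, Even M → ∀ n ∈ Finset.Ico (zetaZeroCount (4 * ((M / 2 : ℕ) : ℝ))) (zetaZeroCount ((M : ℝ) ^ 2)),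
        ‖∑ m ∈ Finset.Icc 1 M, (-1 : ℂ) ^ m * (m : ℂ) ^ (-((1 / 2 : ℂ) + (zetaOrdinate n : ℂ) * I))‖ ≤
          Real.sqrt 2 * ‖∑ k ∈ (Finset.Icc 1 ⌊zetaOrdinate n / (π * M)⌋₊).filter Odd,
              (((1 / Real.sqrt k : ℝ)) : ℂ) * (k : ℂ) ^ (-((zetaOrdinate n : ℂ) * I))‖ +
            (c * (1 + Real.log M) / Real.sqrt M +
              (if |zetaOrdinate n / (π * M) - round (zetaOrdinate n / (π * M))| ≤ η then
                q * Real.sqrt (M / zetaOrdinate n) else 0))) :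
    Summit.RiemannHypothesis.RiemannHypothesis.Theses.EtaLeadingQuarter.EtaLeadingSecondMoment := by
  intro hRH ε hε
  -- the even-`M` bound, reindexed `M = 2K`
  have h2K : Tendsto (fun K : ℕ ↦ 2 * K) atTop atTop :=
    tendsto_atTop_mono (fun K ↦ show id K ≤ 2 * K by simp only [id]; omega) tendsto_id
  have heven : ∀ ε' : ℝ, 0 < ε' → ∀ᶠ K : ℕ in atTop, ((2 * K : ℕ) : ℝ) *
      (∑' ρ : Zeros, (riemannZetaZeroOrder (ρ : ℂ) : ℝ) / (ρ : ℂ).im ^ 2 *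
        ‖-1 + ∑ m ∈ Finset.Icc 2 (2 * K), ((((-1 : ℝ) ^ m * (m : ℝ) ^ (-(1 / 2 : ℝ))) : ℝ) : ℂ) *
          (m : ℂ) ^ ((((ρ : ℂ).im : ℝ) : ℂ) * I)‖ ^ 2) ≤ (1 / 4 + ε') * Real.log ((2 * K : ℕ) : ℝ) := by
    intro ε' hε'
    filter_upwards [h2K.eventually (even_bound_of_engine hRH (hEng hRH) hε')] with K hK
    exact hK (even_two_mul K)
  exact EtaTrial.etaLeadingSecondMoment_of_even heven ε hε

end Summit.RiemannHypothesis.RiemannHypothesis.Theorems.EtaLeadingQuarter.Zeros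

end
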